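import Literature.NumberTheory.ComplexMultiplication.AbelianCMFamilyNondegenerate
import Literature.NumberTheory.ComplexMultiplication.SharedOddCharacterDegenerate
import HarnessLib

/-!
# The odd support of a NONDEGENERATE member is the set of odd characters trivial on `Gal(L/K_i)`

Companion of `AbelianCMFamilyRankCharacters` / `AbelianCMFamilyNondegenerate` (Kubota's Lemma 2 for a family of CM types
of CM fields `e_i : K_i ↪ L` inside one number field `L`, `ι : L → ℂ`, `ρ` the complex conjugation: the rank of the
family is governed by the ODD SUPPORTS `S_i = {χ : χ(ρ) = −1, Σ_{g : ι∘g∘e_i ∈ Φ_i} χ(g) ≠ 0}` of the members, and the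
family is nondegenerate iff the members are and no odd character is seen twice).  This file computes `S_i` for a
NONDEGENERATE member in Galois-theoretic terms, `H_i = Gal(L/e_i(K_i)) = {h | h ∘ e_i = e_i}`:

* `sum_filter_eq_zero_of_apply_ne_one` — a character NON-trivial on `H_i` is never seen by `Φ_i` (the set
  `{g | ι∘g∘e_i ∈ Φ_i}` is a union of cosets `gH_i`, and `Σ_{H_i} χ = 0`) — any member, any `L`;
* **`sum_filter_ne_zero_of_isNondegenerate`** — an ODD character TRIVIAL on `H_i` is seen by every NONDEGENERATE `Φ_i`:
  `χ ∘ r` (`τ ∘ ι = ι ∘ r(τ)`) is an odd character of `Aut(ℂ)` local at `ι ∘ e_i`, so the slot `Hom(K_i, ℂ)` carries a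
  non-zero semi-invariant weight (`SharedOddCharacterDegenerate.exists_semiInvariant_of_local`), which pairs
  non-trivially with the nondegenerate type (`CMTypeRankSharedOddCharacter`), and the pairing is a non-zero multiple of
  `Σ_{g : ι∘g∘e_i ∈ Φ_i} χ(g)` (the fibres of `g ↦ ι∘g∘e_i` are cosets of `H_i`) — Kubota's Lemma 2 for the member, read
  on `Gal(L/ℚ)`;
* **`isNondegenerateFamily_iff_forall_and_pairwise_trivial`** — CONSEQUENTLY, for CM subfields of an ABELIAN `L` with
  NONDEGENERATE types: the family is nondegenerate iff no odd character of `Gal(L/ℚ)` is trivial on two of the `H_i`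
  (`i ≠ j`) — i.e. iff the odd characters of the `Gal(K_i/ℚ)` are pairwise distinct inside `Gal(L/ℚ)^`; the field form
  ("the `K_i` pairwise meet in totally real fields") is `Summits/HodgeConjecture/CorCM/AbelianCMFieldsHodge`.

Theorems only; no definition, no named fact, no `sorry`.

## Sources

* [Kubota1965] T. Kubota, *On the field extension by complex multiplication*, Trans. AMS 118 (1965), §4 Lemma 2.
* [Gordon1999HodgeAVSurvey] B. B. Gordon, *A survey of the Hodge conjecture for abelian varieties*, §3 Theorem (proof),
  7.5, 9.4.1.
* [Shimura1998] G. Shimura, *Abelian Varieties with Complex Multiplication and Modular Functions*, §8.1.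
-/

set_option autoImplicit false

noncomputable section

open scoped BigOperators
open NumberField Module

namespace Literature.NumberTheory.ComplexMultiplication
open Literature.AlgebraicGeometry.Motives (CMType)
open Literature.AlgebraicGeometry.Pohlmann1968

variable {I : Type} {K : I → Type} [∀ i, Field (K i)] [∀ i, NumberField (K i)]
variable {L : Type} [Field L] [NumberField L]

/-! ### Characters non-trivial on `H_i` are not seen -/

section Vanishing

omit [∀ i, NumberField (K i)] in
/-- `ι ∘ (g h) ∘ e_i = ι ∘ g ∘ e_i` for `h ∈ H_i = {h | h ∘ e_i = e_i}`. [cite: Shimura1998, §8.1] -/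
private theorem comp_mul_of_fix (ι : L →+* ℂ) (e : ∀ i, K i →+* L) (i : I) (g : L ≃ₐ[ℚ] L) {h : L ≃ₐ[ℚ] L}
    (hh : ∀ x, h (e i x) = e i x) :
    (ι.comp ((g * h : L ≃ₐ[ℚ] L) : L →+* L)).comp (e i) = (ι.comp (g : L →+* L)).comp (e i) := by
  refine RingHom.ext fun x => ?_
  change ι ((g * h) (e i x)) = ι (g (e i x))
  rw [AlgEquiv.mul_apply, hh]

omit [∀ i, NumberField (K i)] in
open scoped Classical in
/-- **A character non-trivial on `H_i = Gal(L/e_i(K_i))` is not seen by any type of `K_i`**: if `h ∘ e_i = e_i` and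
`χ(h) ≠ 1` then `Σ_{g : ι∘g∘e_i ∈ Φ_i} χ(g) = 0` — the summation set is stable under `g ↦ gh`, so the sum equals `χ(h)`
times itself. [cite: Kubota1965, §4 Lemma 2 (proof)] -/
theorem sum_filter_eq_zero_of_apply_ne_one (ι : L →+* ℂ) (e : ∀ i, K i →+* L) (Φ : ∀ i, CMType (K i)) (i : I)
    (χ : AddChar (Additive (L ≃ₐ[ℚ] L)) ℂ) {h : L ≃ₐ[ℚ] L} (hh : ∀ x, h (e i x) = e i x)
    (hχ : χ (Additive.ofMul h) ≠ 1) :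
    ∑ g ∈ Finset.univ.filter (fun g : L ≃ₐ[ℚ] L => (ι.comp (g : L →+* L)).comp (e i) ∈ (Φ i).1),
      χ (Additive.ofMul g) = 0 := by
  set T := ∑ g ∈ Finset.univ.filter (fun g : L ≃ₐ[ℚ] L => (ι.comp (g : L →+* L)).comp (e i) ∈ (Φ i).1),
    χ (Additive.ofMul g) with hT
  have hmul : T = χ (Additive.ofMul h) * T := by
    rw [hT, Finset.sum_filter, Finset.mul_sum]
    rw [← Fintype.sum_equiv (Equiv.mulRight h)
      (fun g => if (ι.comp ((g * h : L ≃ₐ[ℚ] L) : L →+* L)).comp (e i) ∈ (Φ i).1 then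
        χ (Additive.ofMul (g * h)) else 0)
      (fun g => if (ι.comp (g : L →+* L)).comp (e i) ∈ (Φ i).1 then χ (Additive.ofMul g) else 0)
      (fun g => rfl)]
    refine Finset.sum_congr rfl fun g _ => ?_
    rw [comp_mul_of_fix ι e i g hh]
    split_ifs
    · rw [ofMul_mul, AddChar.map_add_eq_mul, mul_comm]
    · rw [mul_zero]
  have h1 : (1 - χ (Additive.ofMul h)) * T = 0 := by rw [sub_mul, one_mul, ← hmul, sub_self]
  exact (mul_eq_zero.1 h1).resolve_left (sub_ne_zero.2 (Ne.symm hχ))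

end Vanishing

/-! ### Odd characters trivial on `H_i` are seen by every nondegenerate member -/

section NonVanishing

variable [Normal ℚ L]

omit [∀ i, NumberField (K i)] [Normal ℚ L] in
/-- The restriction `r : Aut(ℂ) → Gal(L/ℚ)` (`τ ∘ ι = ι ∘ r(τ)`) is multiplicative and sends complex conjugation to `ρ`
(`ι` is injective). [cite: Shimura1998, §8.1] -/
private theorem restrict_mul (ι : L →+* ℂ) (r : (ℂ ≃+* ℂ) → (L ≃ₐ[ℚ] L))
    (hr : ∀ (τ : ℂ ≃+* ℂ) (x : L), τ (ι x) = ι (r τ x)) (τ τ' : ℂ ≃+* ℂ) : r (τ * τ') = r τ * r τ' := by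
  refine AlgEquiv.ext fun x => ι.injective ?_
  rw [← hr, AlgEquiv.mul_apply, ← hr, ← hr]
  rfl

open scoped Classical in
/-- **The fibres of `g ↦ ι ∘ g ∘ e_i` all have the cardinality of `H_i`**: `Σ_g F(ι∘g∘e_i) = |H_i| · Σ_s F(s)`, where
`|H_i| = #{h | ι ∘ h ∘ e_i = ι ∘ e_i}` (left cosets `g₀H_i`; every `s` is some `ι∘g₀∘e_i`, `L` being normal).
[cite: Shimura1998, §8.1] -/
theorem sum_comp_eq_card_mul_sum (ι : L →+* ℂ) (e : ∀ i, K i →+* L) (i : I) (F : (K i →+* ℂ) → ℂ) :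
    ∑ g : L ≃ₐ[ℚ] L, F ((ι.comp (g : L →+* L)).comp (e i)) =
      (Finset.univ.filter fun h : L ≃ₐ[ℚ] L =>
          (ι.comp (h : L →+* L)).comp (e i) = ι.comp (e i)).card * ∑ s : K i →+* ℂ, F s := by
  classical
  set π : (L ≃ₐ[ℚ] L) → (K i →+* ℂ) := fun g => (ι.comp (g : L →+* L)).comp (e i) with hπ
  have hπmul : ∀ g h : L ≃ₐ[ℚ] L, π (g * h) = π g ↔ π h = π 1 := by
    intro g h
    simp only [hπ, RingHom.ext_iff, RingHom.comp_apply]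
    refine forall_congr' fun x => ?_
    change ι ((g * h) (e i x)) = ι (g (e i x)) ↔ ι (h (e i x)) = ι ((1 : L ≃ₐ[ℚ] L) (e i x))
    rw [AlgEquiv.mul_apply, AlgEquiv.one_apply, ι.injective.eq_iff, ι.injective.eq_iff, g.injective.eq_iff]
  -- every fibre is a left coset of the fibre over `π 1`
  have hfib : ∀ s : K i →+* ℂ, (Finset.univ.filter fun g => π g = s).card =
      (Finset.univ.filter fun h => π h = π 1).card := by
    intro s
    obtain ⟨g₀, hg₀⟩ := exists_eq_comp_algEquiv_comp ι e i s
    have hs : π g₀ = s := hg₀.symm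
    refine Finset.card_bij (fun g _ => g₀⁻¹ * g) (fun g hg => ?_) (fun g _ g' _ hgg' => mul_left_cancel hgg')
      (fun h hh => ⟨g₀ * h, ?_, by rw [← mul_assoc, inv_mul_cancel, one_mul]⟩)
    · rw [Finset.mem_filter] at hg ⊢
      refine ⟨Finset.mem_univ _, ?_⟩
      rw [← hπmul g₀, mul_inv_cancel_left, hg.2, hs]
    · rw [Finset.mem_filter] at hh ⊢
      exact ⟨Finset.mem_univ _, by rw [(hπmul g₀ h).2 hh.2, hs]⟩
  have hπ1 : π 1 = ι.comp (e i) := RingHom.ext fun x => rfl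
  rw [← Finset.sum_fiberwise_of_maps_to (g := π) (fun g _ => Finset.mem_univ (π g)), Finset.mul_sum]
  refine Finset.sum_congr rfl fun s _ => ?_
  rw [Finset.sum_congr rfl fun g (hg : g ∈ Finset.univ.filter fun g => π g = s) =>
      (show F (π g) = F s by rw [(Finset.mem_filter.1 hg).2]), Finset.sum_const, nsmul_eq_mul, hfib s, hπ1]

variable [∀ i, IsCMField (K i)]

open scoped Classical in
/-- **An odd character trivial on `H_i` is seen by every NONDEGENERATE type of `K_i`** (Kubota's Lemma 2 for the member,
read on `Gal(L/ℚ)`): if `Φ_i` is nondegenerate, `χ(ρ) = −1` and `χ(h) = 1` whenever `h ∘ e_i = e_i`, then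
`Σ_{g : ι∘g∘e_i ∈ Φ_i} χ(g) ≠ 0`.  Proof: `χ ∘ r` is an odd character of `Aut(ℂ)` local at `ι ∘ e_i`; the resulting
semi-invariant weight on `Hom(K_i, ℂ)` pairs non-trivially with the nondegenerate `Φ_i`, and that pairing is
`f(ι∘e_i) |H_i|⁻¹ · 2 Σ_{g : ι∘g∘e_i ∈ Φ_i} χ(g)`. [cite: Kubota1965, §4 Lemma 2] [cite: Gordon1999HodgeAVSurvey, 9.4.1] -/
theorem sum_filter_ne_zero_of_isNondegenerate (ι : L →+* ℂ) (e : ∀ i, K i →+* L) (ρ : L ≃ₐ[ℚ] L)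
    (hρ : ∀ x, ι (ρ x) = starRingEnd ℂ (ι x)) (Φ : ∀ i, CMType (K i)) (i : I) (hnd : IsNondegenerate (Φ i))
    (χ : AddChar (Additive (L ≃ₐ[ℚ] L)) ℂ) (hodd : χ (Additive.ofMul ρ) = -1)
    (htriv : ∀ h : L ≃ₐ[ℚ] L, (∀ x, h (e i x) = e i x) → χ (Additive.ofMul h) = 1) :
    ∑ g ∈ Finset.univ.filter (fun g : L ≃ₐ[ℚ] L => (ι.comp (g : L →+* L)).comp (e i) ∈ (Φ i).1),
      χ (Additive.ofMul g) ≠ 0 := by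
  -- the restriction `r` and the odd character `χ ∘ r` of `Aut(ℂ)`
  choose r hr using fun τ : ℂ ≃+* ℂ => exists_algEquiv_comp_eq_smul ι τ
  have hrmul := restrict_mul ι r hr
  have hrconj : r (starRingAut : ℂ ≃+* ℂ) = ρ := by
    refine AlgEquiv.ext fun x => ι.injective ?_
    rw [← hr, hρ]; rfl
  set χ' : (ℂ ≃+* ℂ) → ℂ := fun τ => χ (Additive.ofMul (r τ)) with hχ'
  have hχ'mul : ∀ τ τ' : ℂ ≃+* ℂ, χ' (τ * τ') = χ' τ * χ' τ' := fun τ τ' => by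
    simp only [hχ', hrmul, ofMul_mul, AddChar.map_add_eq_mul]
  have hχ'odd : χ' (starRingAut : ℂ ≃+* ℂ) = -1 := by simp only [hχ', hrconj, hodd]
  have hχ'1 : χ' 1 ≠ 0 := by
    have h11 : r 1 = 1 := by
      have := hrmul 1 1
      rw [mul_one] at this
      exact mul_left_cancel (a := r 1) (by rw [← this, mul_one])
    simp only [hχ', h11, ofMul_one, AddChar.map_zero_eq_one]; exact one_ne_zero
  -- locality at `ι ∘ e_i`: `χ ∘ r` only depends on `τ ∘ ι ∘ e_i` because `χ` is trivial on `H_i`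
  have hloc : ∀ τ τ' : ℂ ≃+* ℂ, τ • ι.comp (e i) = τ' • ι.comp (e i) → χ' τ = χ' τ' := by
    intro τ τ' hττ'
    have hfix : ∀ x, ((r τ')⁻¹ * r τ) (e i x) = e i x := by
      intro x
      rw [AlgEquiv.mul_apply]
      apply (r τ').injective
      rw [← AlgEquiv.mul_apply, mul_inv_cancel, AlgEquiv.one_apply]
      apply ι.injective
      rw [← hr, ← hr]
      exact RingHom.congr_fun hττ' x
    have h1 := htriv _ hfix
    rw [ofMul_mul, ofMul_inv, AddChar.map_add_eq_mul, AddChar.map_neg_eq_inv] at h1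
    have hne : χ (Additive.ofMul (r τ')) ≠ 0 := fun h0 => by rw [h0, inv_zero, zero_mul] at h1; exact zero_ne_one h1
    show χ (Additive.ofMul (r τ)) = χ (Additive.ofMul (r τ'))
    calc χ (Additive.ofMul (r τ)) = χ (Additive.ofMul (r τ')) * ((χ (Additive.ofMul (r τ')))⁻¹ *
          χ (Additive.ofMul (r τ))) := by rw [← mul_assoc, mul_inv_cancel₀ hne, one_mul]
      _ = χ (Additive.ofMul (r τ')) := by rw [h1, mul_one]
  -- the semi-invariant weight and its non-trivial pairing with `Φ_i`
  obtain ⟨f, hf0, hf⟩ := exists_semiInvariant_of_local χ' hχ'mul hχ'1 (ι.comp (e i)) hloc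
  have hpair := (isCMTypeWith_conj (Φ i)).sum_mul_antiVec_ne_zero_of_typeRank_eq
    (by rw [Embeddings.card]; exact hnd) χ' hχ'odd f hf hf0
  -- `f(ι∘g∘e_i) = χ(g) f(ι∘e_i)`
  have hfg : ∀ g : L ≃ₐ[ℚ] L, f ((ι.comp (g : L →+* L)).comp (e i)) = χ (Additive.ofMul g) * f (ι.comp (e i)) := by
    intro g
    obtain ⟨τ, hτ⟩ := exists_ringEquiv_comp_eq_algEquiv ι g
    have hrτ : r τ = g := AlgEquiv.ext fun x => ι.injective (by rw [← hr, hτ])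
    have hsmul : τ • ι.comp (e i) = (ι.comp (g : L →+* L)).comp (e i) :=
      RingHom.ext fun x => by rw [ringEquiv_smul_apply, RingHom.comp_apply, hτ]; rfl
    rw [← hsmul, hf]
    show χ (Additive.ofMul (r τ)) * f (ι.comp (e i)) = _
    rw [hrτ]
  -- the pairing, summed over `G`, is `f(ι∘e_i) (2 Σ_{filter} χ − Σ_G χ)`
  have hpt : ∀ g : L ≃ₐ[ℚ] L, f ((ι.comp (g : L →+* L)).comp (e i)) *
      (antiVec (Φ i).1 (1 : ℂ ≃+* ℂ) ((ι.comp (g : L →+* L)).comp (e i)) : ℂ) =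
      f (ι.comp (e i)) * (2 * (if (ι.comp (g : L →+* L)).comp (e i) ∈ (Φ i).1 then χ (Additive.ofMul g) else 0) -
        χ (Additive.ofMul g)) := by
    intro g
    rw [hfg, antiVec]
    by_cases hg : (ι.comp (g : L →+* L)).comp (e i) ∈ (Φ i).1
    · rw [if_pos hg, translateInd_of_mem (show (1 : ℂ ≃+* ℂ) • _ ∈ (Φ i).1 by rwa [one_smul])]
      push_cast; ring
    · rw [if_neg hg, translateInd_of_not_mem (show ¬(1 : ℂ ≃+* ℂ) • _ ∈ (Φ i).1 by rwa [one_smul])]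
      push_cast; ring
  have hsumG : ∑ g : L ≃ₐ[ℚ] L, f ((ι.comp (g : L →+* L)).comp (e i)) *
      (antiVec (Φ i).1 (1 : ℂ ≃+* ℂ) ((ι.comp (g : L →+* L)).comp (e i)) : ℂ) =
      f (ι.comp (e i)) * (2 * ∑ g ∈ Finset.univ.filter
        (fun g : L ≃ₐ[ℚ] L => (ι.comp (g : L →+* L)).comp (e i) ∈ (Φ i).1), χ (Additive.ofMul g) -
        ∑ g : L ≃ₐ[ℚ] L, χ (Additive.ofMul g)) := by
    rw [Finset.sum_congr rfl (fun g _ => hpt g), ← Finset.mul_sum, Finset.sum_sub_distrib, ← Finset.mul_sum,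
      Finset.sum_filter]
  -- `Σ_G χ = 0` (`χ` is odd, hence non-trivial)
  have hχ0 : ∑ g : L ≃ₐ[ℚ] L, χ (Additive.ofMul g) = 0 := by
    have hne : χ ≠ 0 := fun h0 => by rw [h0, AddChar.zero_apply] at hodd; norm_num at hodd
    have := AddChar.sum_eq_ite χ
    rw [if_neg hne] at this
    rw [← this]
    exact Fintype.sum_equiv Additive.ofMul _ _ fun g => rfl
  -- conclude
  intro hzero
  rw [sum_comp_eq_card_mul_sum ι e i (fun s => f s * (antiVec (Φ i).1 (1 : ℂ ≃+* ℂ) s : ℂ)), hzero, hχ0,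
    mul_zero, sub_zero, mul_zero] at hsumG
  exact (mul_eq_zero.1 hsumG).elim (fun hc => by
    have hpos : 0 < (Finset.univ.filter fun h : L ≃ₐ[ℚ] L =>
        (ι.comp (h : L →+* L)).comp (e i) = ι.comp (e i)).card :=
      Finset.card_pos.2 ⟨1, Finset.mem_filter.2 ⟨Finset.mem_univ _, RingHom.ext fun x => rfl⟩⟩
    exact (Nat.cast_ne_zero.2 hpos.ne') hc) hpair

end NonVanishing

/-! ### The criterion for nondegenerate members of an abelian field -/

section Criterion

variable [IsAbelianGalois ℚ L] [∀ i, IsCMField (K i)] [Fintype I] [Nonempty I]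

open scoped Classical in
/-- **Kubota's Lemma 2 for families with NONDEGENERATE members (Galois form).**  For CM fields `e_i : K_i ↪ L` inside an
ABELIAN number field `L` with every `Φ_i` nondegenerate: the family is nondegenerate iff no ODD character of `Gal(L/ℚ)`
is trivial on `H_i` and on `H_j` for two indices `i ≠ j` (`H_i = {h | h ∘ e_i = e_i} = Gal(L/K_i)`) — i.e. iff the odd
characters of the quotients `Gal(K_i/ℚ)` are pairwise disjoint inside `Gal(L/ℚ)^`; on abelian varieties:
`∏_i A_i^{k_i}` never carries an exceptional Hodge class iff no two `K_i` share an odd character.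
[cite: Kubota1965, §4 Lemma 2] [cite: Gordon1999HodgeAVSurvey, 7.5 and 9.4.1] -/
theorem isNondegenerateFamily_iff_pairwise_of_forall_isNondegenerate (ι : L →+* ℂ) (e : ∀ i, K i →+* L)
    (ρ : L ≃ₐ[ℚ] L) (hρ : ∀ x, ι (ρ x) = starRingEnd ℂ (ι x)) (Φ : ∀ i, CMType (K i))
    (hnd : ∀ i, IsNondegenerate (Φ i)) :
    CMAlgebra.IsNondegenerateFamily Φ ↔
      ∀ χ : AddChar (Additive (L ≃ₐ[ℚ] L)) ℂ, χ (Additive.ofMul ρ) = -1 → ∀ i j : I, i ≠ j →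
        ¬((∀ h : L ≃ₐ[ℚ] L, (∀ x, h (e i x) = e i x) → χ (Additive.ofMul h) = 1) ∧
          ∀ h : L ≃ₐ[ℚ] L, (∀ x, h (e j x) = e j x) → χ (Additive.ofMul h) = 1) := by
  rw [isNondegenerateFamily_iff_forall_and_pairwise_oddCharacters ι e ρ hρ Φ]
  -- "seen by `Φ_k`" ⟺ "trivial on `H_k`" for nondegenerate members
  have hseen : ∀ (χ : AddChar (Additive (L ≃ₐ[ℚ] L)) ℂ), χ (Additive.ofMul ρ) = -1 → ∀ k : I,
      (∑ g ∈ Finset.univ.filter (fun g : L ≃ₐ[ℚ] L => (ι.comp (g : L →+* L)).comp (e k) ∈ (Φ k).1),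
        χ (Additive.ofMul g) ≠ 0) ↔ ∀ h : L ≃ₐ[ℚ] L, (∀ x, h (e k x) = e k x) → χ (Additive.ofMul h) = 1 := by
    intro χ hχ k
    constructor
    · intro hs h hh
      by_contra hne
      exact hs (sum_filter_eq_zero_of_apply_ne_one ι e Φ k χ hh hne)
    · intro ht
      exact sum_filter_ne_zero_of_isNondegenerate ι e ρ hρ Φ k (hnd k) χ hχ ht
  refine ⟨fun h χ hχ i j hij => ?_, fun h => ⟨hnd, fun χ hχ i j hij => ?_⟩⟩
  · rw [← hseen χ hχ i, ← hseen χ hχ j]; exact h.2 χ hχ i j hij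
  · rw [hseen χ hχ i, hseen χ hχ j]; exact h χ hχ i j hij

end Criterion

end Literature.NumberTheory.ComplexMultiplication
end
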